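import Literature.MathematicalPhysics.QuantumLattice.SectorSymbolMaster
import Mathlib.Analysis.Calculus.ContDiff.Bounds
import HarnessLib

/-!
# The master symbol is smooth; `h`-uniform derivative bounds of the rescaled sector symbols
(Benfatto–Giuliani–Mastropietro 2006, Lemma 2.2: the `h`-uniform symbol estimates, part 3)

Topic `Literature/MathematicalPhysics/QuantumLattice`; continues `SectorSymbolMaster.lean`
(`rescaledSectorSymbol e₀ n ω = 4ⁿ · Φ̂(θ_{n,ω}, ·; 2^{-n})`). PROVED here:

* `contDiff_masterLift` — the master symbol is jointly `C^∞` in `((θ₀, s), t) ∈ ℝ² × ℝ³`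
  (compositions of the smooth pieces of `SectorChartPoint` / `SectorSymbolMaster`; the shell
  profile vanishes near `0`, so `G ∘ √·` is smooth);
* `rescaledSectorSymbol_eq_smul_masterLift` — `rescaledSectorSymbol = 4ⁿ • Φ̂((θ_{n,ω}, 2^{-n}), ·)`;
* the **support box** in rescaled coordinates (`abs_le_of_rescaledSectorSymbol_ne_zero`): on the
  support `|t₀| ≤ e₀`, `|t₁| ≤ C₁`, `|t₂| ≤ C₂` with `C₁ = normalExtentConst`, `C₂ = tangentExtentConst`
  INDEPENDENT of `n, ω` (the sector box of `AnisotropicSectorSupport` read in the chart: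
  `k'₁ = 4^{-n}t₁`, `k'₂ = 2^{-n}t₂`);
* **`exists_norm_iteratedFDeriv_rescaledSectorSymbol_le`** — for every order `m` there is `B_m ≥ 0`
  with `‖D^m (rescaledSectorSymbol e₀ n ω)(t)‖ ≤ 4ⁿ B_m` for ALL `n`, all sectors `0 ≤ ω < 2^{n+1}` and
  all `t`: the `h`-UNIFORMITY of BGM's symbol estimates ("the bounds hold uniformly in `h`"), by
  COMPACTNESS — `B_m` bounds the (continuous) `m`-th derivative of the master symbol over
  `(θ₀, s) ∈ [0, 2π] × [0, 1]` and `t` in the support box; off the box the symbol vanishes identically.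

Everything is PROVED; the definitions are `masterLift` and the two extent constants.

## Sources

* G. Benfatto, A. Giuliani, V. Mastropietro, Ann. Henri Poincaré 7 (2006) 809–898, §2.5
  Lemma 2.2 and the `h`-uniformity of (2.50)–(2.52) (arXiv:cond-mat/0507686 p. 11). [BenfattoGiulianiMastropietro2006]
* G. Benfatto, A. Giuliani, V. Mastropietro, Ann. Henri Poincaré 4 (2003) 137–193, §7.2. [BenfattoGiulianiMastropietro2003]
-/

noncomputable section

open Real Set Complex Function Metric
open scoped Topology ComplexConjugate
open Literature.Analysis.Calculus Literature.Analysis.SpecialFunctions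

namespace Literature.MathematicalPhysics.QuantumLattice

/-! ### Joint smoothness of the master symbol -/

/-- The master symbol as a function of `((θ₀, s), t) ∈ ℝ² × ℝ³`. [cite: BenfattoGiulianiMastropietro2006, §2.5 Lemma 2.2] -/
def masterLift (μ e₀ : ℝ) (q : (ℝ × ℝ) × MomSpace) : ℂ :=
  masterSymbol μ e₀ (q.1.1, q.2 1, q.2 2) (q.2 0) q.1.2

/-- The coordinates of `ℝ³` are smooth functions on `ℝ² × ℝ³`. [folklore] -/
theorem contDiff_momSpace_coord (i : Fin 3) {n : WithTop ℕ∞} : ContDiff ℝ n fun q : (ℝ × ℝ) × MomSpace => q.2 i :=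
  (contDiff_piLp_apply (𝕜 := ℝ) (p := 2) (n := n) (i := i)).comp contDiff_snd

section Smooth

variable {μ : ℝ} (hμ₁ : -4 < μ) (hμ₂ : μ < -2 - Real.sqrt 2)
include hμ₁ hμ₂

/-- **The master symbol is jointly smooth.** [cite: BenfattoGiulianiMastropietro2006, §2.5 Lemma 2.2] -/
theorem contDiff_masterLift {e₀ : ℝ} (he : 0 < e₀) : ContDiff ℝ ((⊤ : ℕ∞) : WithTop ℕ∞) (masterLift μ e₀) := by
  have hθ : ContDiff ℝ ((⊤ : ℕ∞) : WithTop ℕ∞) fun q : (ℝ × ℝ) × MomSpace => q.1.1 := contDiff_fst.comp contDiff_fst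
  have hs : ContDiff ℝ ((⊤ : ℕ∞) : WithTop ℕ∞) fun q : (ℝ × ℝ) × MomSpace => q.1.2 := contDiff_snd.comp contDiff_fst
  have h0 := contDiff_momSpace_coord 0 (n := ((⊤ : ℕ∞) : WithTop ℕ∞))
  have h1 := contDiff_momSpace_coord 1 (n := ((⊤ : ℕ∞) : WithTop ℕ∞))
  have h2 := contDiff_momSpace_coord 2 (n := ((⊤ : ℕ∞) : WithTop ℕ∞))
  have hx : ContDiff ℝ ((⊤ : ℕ∞) : WithTop ℕ∞) fun q : (ℝ × ℝ) × MomSpace => ((q.1.1, q.2 1, q.2 2) : ℝ × ℝ × ℝ) :=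
    hθ.prodMk (h1.prodMk h2)
  have hxs : ContDiff ℝ ((⊤ : ℕ∞) : WithTop ℕ∞)
      fun q : (ℝ × ℝ) × MomSpace => (((q.1.1, q.2 1, q.2 2), q.1.2) : (ℝ × ℝ × ℝ) × ℝ) :=
    hx.prodMk hs
  -- the rescaled dispersion and denominator
  have hE : ContDiff ℝ ((⊤ : ℕ∞) : WithTop ℕ∞)
      fun q : (ℝ × ℝ) × MomSpace => rescaledDispersion μ ((q.1.1, q.2 1, q.2 2), q.1.2) :=
    (contDiff_rescaledDispersion hμ₁ hμ₂).comp hxs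
  have hD : ContDiff ℝ ((⊤ : ℕ∞) : WithTop ℕ∞)
      fun q : (ℝ × ℝ) × MomSpace => rescaledDenom μ (q.1.1, q.2 1, q.2 2) (q.2 0) q.1.2 := by
    unfold rescaledDenom
    exact (contDiff_const.mul (Complex.ofRealCLM.contDiff.comp h0)).neg.add (Complex.ofRealCLM.contDiff.comp hE)
  -- the shell factor `G(√(t₀² + Ẽ²))`
  have hG : ContDiff ℝ ((⊤ : ℕ∞) : WithTop ℕ∞) fun q : (ℝ × ℝ) × MomSpace =>
      gnShell 4 e₀ 0 (Real.sqrt (q.2 0 ^ 2 + rescaledDispersion μ ((q.1.1, q.2 1, q.2 2), q.1.2) ^ 2)) := by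
    have hsq : ContDiff ℝ ((⊤ : ℕ∞) : WithTop ℕ∞) fun r : ℝ => gnShell 4 e₀ 0 (Real.sqrt r) :=
      contDiff_comp_sqrt_of_eq_zero (contDiff_gnShell 4 e₀ 0) (a := e₀ * (4 : ℝ) ^ ((0 : ℤ) - 2))
        (mul_pos he (zpow_pos (by norm_num) _)) fun t ht => gnShell_eq_zero_of_le (by norm_num) he ht
    exact hsq.comp ((h0.pow 2).add (hE.pow 2))
  -- the angular factors and the zone bump
  -- (the binary maps are composed in `uncurry` form and rewritten with `uncurry_apply_pair`, so
  -- that no definitional unfolding of `sectorUFun`/`sectorChartPoint` is ever attempted)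
  have hu : ContDiff ℝ ((⊤ : ℕ∞) : WithTop ℕ∞)
      fun q : (ℝ × ℝ) × MomSpace => uncurry (sectorUFun μ) ((q.1.1, q.2 1, q.2 2), q.1.2) :=
    (contDiff_uncurry_sectorUFun hμ₁ hμ₂).comp hxs
  simp only [uncurry_apply_pair] at hu
  have hk : ContDiff ℝ ((⊤ : ℕ∞) : WithTop ℕ∞)
      fun q : (ℝ × ℝ) × MomSpace => uncurry (sectorChartPoint μ) ((q.1.1, q.2 1, q.2 2), q.1.2) :=
    (contDiff_uncurry_sectorChartPoint hμ₁ hμ₂).comp hxs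
  simp only [uncurry_apply_pair] at hk
  have h2r : 0 < 2 * truncRadius μ := by linarith [truncRadius_pos hμ₁ (μ := μ)]
  have hψ : ContDiff ℝ ((⊤ : ℕ∞) : WithTop ℕ∞) fun q : (ℝ × ℝ) × MomSpace =>
      truncOne (2 * truncRadius μ) (Real.cos (3 * π / 4)) (Real.cos (7 * π / 8)) (sectorUFun μ (q.1.1, q.2 1, q.2 2) q.1.2) :=
    (contDiff_truncOne (c₁ := Real.cos (3 * π / 4)) (c₂ := Real.cos (7 * π / 8)) h2r).comp hu
  have hW : ContDiff ℝ ((⊤ : ℕ∞) : WithTop ℕ∞)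
      fun q : (ℝ × ℝ) × MomSpace => sectorUnitWeight (rescaledAngle μ ((q.1.1, q.2 1, q.2 2), q.1.2) / π) :=
    contDiff_sectorUnitWeight.comp (((contDiff_rescaledAngle hμ₁ hμ₂).comp hxs).div_const _)
  have hχ : ContDiff ℝ ((⊤ : ℕ∞) : WithTop ℕ∞)
      fun q : (ℝ × ℝ) × MomSpace => zoneBump (sectorChartPoint μ (q.1.1, q.2 1, q.2 2) q.1.2) :=
    contDiff_zoneBump.comp hk
  -- the inverse factor `conj(D̃) η(|D̃|²)`
  have hnSq : ContDiff ℝ ((⊤ : ℕ∞) : WithTop ℕ∞) fun q : (ℝ × ℝ) × MomSpace =>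
      Complex.normSq (rescaledDenom μ (q.1.1, q.2 1, q.2 2) (q.2 0) q.1.2) := by
    have hfun : (fun q : (ℝ × ℝ) × MomSpace => Complex.normSq (rescaledDenom μ (q.1.1, q.2 1, q.2 2) (q.2 0) q.1.2)) =
        fun q => ‖rescaledDenom μ (q.1.1, q.2 1, q.2 2) (q.2 0) q.1.2‖ ^ 2 := by
      funext q; exact Complex.normSq_eq_norm_sq _
    rw [hfun]
    exact hD.norm_sq ℝ
  have hη : ContDiff ℝ ((⊤ : ℕ∞) : WithTop ℕ∞) fun q : (ℝ × ℝ) × MomSpace =>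
      sectorInvCutoff ((e₀ / 16) ^ 2) (Complex.normSq (rescaledDenom μ (q.1.1, q.2 1, q.2 2) (q.2 0) q.1.2)) :=
    (contDiff_sectorInvCutoff (q₀ := (e₀ / 16) ^ 2) (by positivity)).comp hnSq
  have hconj : ContDiff ℝ ((⊤ : ℕ∞) : WithTop ℕ∞)
      fun q : (ℝ × ℝ) × MomSpace => conj (rescaledDenom μ (q.1.1, q.2 1, q.2 2) (q.2 0) q.1.2) :=
    Complex.conjCLE.contDiff.comp hD
  have hreal := ((hG.mul hψ).mul hW).mul hχ
  have hcplx := hconj.mul (Complex.ofRealCLM.contDiff.comp hη)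
  have hfin := (Complex.ofRealCLM.contDiff.comp hreal).mul hcplx
  have key : masterLift μ e₀ = fun q : (ℝ × ℝ) × MomSpace =>
      ((gnShell 4 e₀ 0 (Real.sqrt (q.2 0 ^ 2 + rescaledDispersion μ ((q.1.1, q.2 1, q.2 2), q.1.2) ^ 2)) *
        truncOne (2 * truncRadius μ) (Real.cos (3 * π / 4)) (Real.cos (7 * π / 8)) (sectorUFun μ (q.1.1, q.2 1, q.2 2) q.1.2) *
        sectorUnitWeight (rescaledAngle μ ((q.1.1, q.2 1, q.2 2), q.1.2) / π) *
        zoneBump (sectorChartPoint μ (q.1.1, q.2 1, q.2 2) q.1.2) : ℝ) : ℂ) *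
      (conj (rescaledDenom μ (q.1.1, q.2 1, q.2 2) (q.2 0) q.1.2) *
        (sectorInvCutoff ((e₀ / 16) ^ 2) (Complex.normSq (rescaledDenom μ (q.1.1, q.2 1, q.2 2) (q.2 0) q.1.2)) : ℂ)) := by
    funext q; rfl
  rw [key]
  exact hfin

/-- **`rescaledSectorSymbol = 4ⁿ • Φ̂((θ_{n,ω}, 2^{-n}), ·)`.** [cite: BenfattoGiulianiMastropietro2006, §2.5 Lemma 2.2] -/
theorem rescaledSectorSymbol_eq_smul_masterLift {e₀ : ℝ} (he : 0 < e₀) (he' : e₀ ≤ (4 + μ) / 2) (n : ℕ) (ω : ℤ) :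
    rescaledSectorSymbol hμ₁ hμ₂ e₀ n ω = fun t =>
      (((4 : ℝ) ^ n : ℝ) : ℂ) • masterLift μ e₀ ((((ω : ℝ) + 1 / 2) * sectorWidth n, (2 : ℝ) ^ (-(n : ℤ))), t) := by
  funext t
  rw [rescaledSectorSymbol_eq_masterSymbol hμ₁ hμ₂ he he' n ω t, smul_eq_mul]
  rfl

end Smooth

/-! ### The support box in rescaled coordinates -/

/-- `C₁ = C_r e₀ + C_n (9/16)π²` (so that `normalExtent n = C₁ 4^{-n}`). [cite: BenfattoGiulianiMastropietro2006, §2.5 (2.47)] -/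
def normalExtentConst (μ e₀ : ℝ) : ℝ :=
  π / (4 * Real.sqrt ((4 + μ) / 2)) * e₀ +
    2 * accelBound μ * Real.sqrt (π ^ 2 / 8 + (4 * π ^ 3 / (μ + 4)) ^ 2) / Real.sqrt (μ + 4) * (9 / 16 * π ^ 2)

/-- `C₂ = C_r e₀ + C_t (3/4)π` (so that `tangentExtent n ≤ C₂ 2^{-n}`). [cite: BenfattoGiulianiMastropietro2006, §2.5 (2.47)] -/
def tangentExtentConst (μ e₀ : ℝ) : ℝ :=
  π / (4 * Real.sqrt ((4 + μ) / 2)) * e₀ + 2 * Real.sqrt (π ^ 2 / 8 + (4 * π ^ 3 / (μ + 4)) ^ 2) * (3 / 4 * π)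

/-- `w_n = π 2^{-n}`. [folklore] -/
theorem sectorWidth_eq_pi_mul (n : ℕ) : sectorWidth n = π * (2 : ℝ) ^ (-(n : ℤ)) := by
  rw [sectorWidth, zpow_neg, zpow_natCast, div_eq_mul_inv]

/-- `4^{-n} = (2^{-n})²`. [folklore] -/
theorem four_zpow_neg_eq_sq (n : ℕ) : (4 : ℝ) ^ (-(n : ℤ)) = ((2 : ℝ) ^ (-(n : ℤ))) ^ 2 := by
  rw [← zpow_natCast, ← zpow_mul, show (4 : ℝ) = 2 ^ (2 : ℤ) by norm_num, ← zpow_mul]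
  congr 1; ring

/-- `normalExtent n = C₁ 4^{-n}`. [folklore] -/
theorem normalExtent_eq (μ e₀ : ℝ) (n : ℕ) : normalExtent μ e₀ n = normalExtentConst μ e₀ * (4 : ℝ) ^ (-(n : ℤ)) := by
  rw [normalExtent, normalExtentConst, sectorWidth_eq_pi_mul, four_zpow_neg_eq_sq]; ring

/-- `tangentExtent n ≤ C₂ 2^{-n}` (`-4 < μ`, `0 ≤ e₀`). [folklore] -/
theorem tangentExtent_le {μ e₀ : ℝ} (hμ₁ : -4 < μ) (he : 0 ≤ e₀) (n : ℕ) :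
    tangentExtent μ e₀ n ≤ tangentExtentConst μ e₀ * (2 : ℝ) ^ (-(n : ℤ)) := by
  have h4 : 0 < 4 + μ := by linarith
  have h2pos : 0 < (2 : ℝ) ^ (-(n : ℤ)) := zpow_pos (by norm_num) _
  have h2le : (2 : ℝ) ^ (-(n : ℤ)) ≤ 1 := zpow_le_one_of_nonpos₀ (by norm_num) (by simp)
  have h4le2 : (4 : ℝ) ^ (-(n : ℤ)) ≤ (2 : ℝ) ^ (-(n : ℤ)) := by
    rw [four_zpow_neg_eq_sq, sq]; exact mul_le_of_le_one_left h2pos.le h2le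
  have hCr : 0 ≤ π / (4 * Real.sqrt ((4 + μ) / 2)) * e₀ := by positivity
  have heq : tangentExtent μ e₀ n = π / (4 * Real.sqrt ((4 + μ) / 2)) * e₀ * (4 : ℝ) ^ (-(n : ℤ)) +
      2 * Real.sqrt (π ^ 2 / 8 + (4 * π ^ 3 / (μ + 4)) ^ 2) * (3 / 4 * π) * (2 : ℝ) ^ (-(n : ℤ)) := by
    rw [tangentExtent, sectorWidth_eq_pi_mul]; ring
  rw [heq, tangentExtentConst, add_mul]
  exact add_le_add (mul_le_mul_of_nonneg_left h4le2 hCr) le_rfl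

section Box

variable {μ : ℝ} (hμ₁ : -4 < μ) (hμ₂ : μ < -2 - Real.sqrt 2)
include hμ₁ hμ₂

/-- **The support box in rescaled coordinates**: if `rescaledSectorSymbol e₀ n ω (t) ≠ 0` then
`|t₀| ≤ e₀`, `|t₁| ≤ C₁`, `|t₂| ≤ C₂`. [cite: BenfattoGiulianiMastropietro2006, §2.5 (2.46)–(2.47)] -/
theorem abs_le_of_rescaledSectorSymbol_ne_zero {e₀ : ℝ} (he : 0 < e₀) (he' : e₀ ≤ (4 + μ) / 2) {n : ℕ} {ω : ℤ}
    {t : MomSpace} (h : rescaledSectorSymbol hμ₁ hμ₂ e₀ n ω t ≠ 0) :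
    |t 0| ≤ e₀ ∧ |t 1| ≤ normalExtentConst μ e₀ ∧ |t 2| ≤ tangentExtentConst μ e₀ := by
  set θ₀ : ℝ := ((ω : ℝ) + 1 / 2) * sectorWidth n with hθ₀
  have h4pos : 0 < (4 : ℝ) ^ (-(n : ℤ)) := zpow_pos (by norm_num) _
  have h2pos : 0 < (2 : ℝ) ^ (-(n : ℤ)) := zpow_pos (by norm_num) _
  have hsplit := splitMomentum_fermiBasePoint_add_sectorChart hμ₁ hμ₂ θ₀ n t
  have hS : sectorSymbol e₀ μ n ω ((4 : ℝ) ^ (-(n : ℤ)) * t 0,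
      sectorChartPoint μ (θ₀, t 1, t 2) ((2 : ℝ) ^ (-(n : ℤ)))) ≠ 0 := by
    intro h0; apply h
    change sectorSymbol e₀ μ n ω (splitMomentum (fermiBasePoint μ θ₀ + sectorChart hμ₁ hμ₂ θ₀ n t)) = 0
    rw [hsplit]; exact h0
  obtain ⟨h1, h2, h3⟩ := sectorSymbol_ne_zero hμ₁ hμ₂ he he' hS
  have hnc := normalCoord_sectorChartPoint hμ₁ hμ₂ (θ₀, t 1, t 2) ((2 : ℝ) ^ (-(n : ℤ)))
  have htc := tangentCoord_sectorChartPoint hμ₁ hμ₂ (θ₀, t 1, t 2) ((2 : ℝ) ^ (-(n : ℤ)))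
  simp only at hnc htc
  rw [← four_zpow_neg_eq_sq] at hnc
  rw [hnc] at h2; rw [htc] at h3
  refine ⟨?_, ?_, ?_⟩
  · have h0 : |(4 : ℝ) ^ (-(n : ℤ)) * t 0| ≤ (4 : ℝ) ^ (-(n : ℤ)) * e₀ := by
      rw [mul_comm ((4 : ℝ) ^ (-(n : ℤ))) e₀]; exact abs_le.2 ⟨by linarith [h1.1], h1.2⟩
    rw [abs_mul, abs_of_pos h4pos] at h0
    exact le_of_mul_le_mul_left h0 h4pos
  · have h2' := h2.trans (le_of_eq (normalExtent_eq μ e₀ n))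
    rw [abs_mul, abs_of_pos h4pos, mul_comm (normalExtentConst μ e₀)] at h2'
    exact le_of_mul_le_mul_left h2' h4pos
  · have h3' := h3.trans (tangentExtent_le hμ₁ he.le n)
    rw [abs_mul, abs_of_pos h2pos, mul_comm (tangentExtentConst μ e₀)] at h3'
    exact le_of_mul_le_mul_left h3' h2pos

end Box

/-! ### `h`-uniform derivative bounds by compactness -/

/-- The support box `{|t₀| ≤ a, |t₁| ≤ b, |t₂| ≤ c}` is compact. [folklore] -/
theorem isCompact_momBox (a b c : ℝ) : IsCompact {t : MomSpace | |t 0| ≤ a ∧ |t 1| ≤ b ∧ |t 2| ≤ c} := by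
  refine Metric.isCompact_of_isClosed_isBounded ?_ ?_
  · exact (isClosed_le (continuous_abs.comp (EuclideanSpace.proj (0 : Fin 3)).continuous) continuous_const).inter
      ((isClosed_le (continuous_abs.comp (EuclideanSpace.proj (1 : Fin 3)).continuous) continuous_const).inter
        (isClosed_le (continuous_abs.comp (EuclideanSpace.proj (2 : Fin 3)).continuous) continuous_const))
  · refine (Metric.isBounded_closedBall (x := (0 : MomSpace)) (r := |a| + |b| + |c|)).subset fun t ht => ?_
    obtain ⟨h0, h1, h2⟩ := ht
    have ha : |t 0| ≤ |a| := h0.trans (le_abs_self a)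
    have hb : |t 1| ≤ |b| := h1.trans (le_abs_self b)
    have hc : |t 2| ≤ |c| := h2.trans (le_abs_self c)
    rw [mem_closedBall, dist_zero_right, EuclideanSpace.norm_eq, Fin.sum_univ_three]
    simp only [Real.norm_eq_abs, sq_abs]
    refine Real.sqrt_le_iff.2 ⟨by positivity, ?_⟩
    have e0 : t 0 ^ 2 = |t 0| ^ 2 := (sq_abs _).symm
    have e1 : t 1 ^ 2 = |t 1| ^ 2 := (sq_abs _).symm
    have e2 : t 2 ^ 2 = |t 2| ^ 2 := (sq_abs _).symm
    rw [e0, e1, e2]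
    nlinarith [abs_nonneg (t 0), abs_nonneg (t 1), abs_nonneg (t 2), abs_nonneg a, abs_nonneg b, abs_nonneg c]

/-- **Derivatives in `t` of a slice of a smooth function on `ℝ² × ℝ³` are bounded by the full
derivatives**: `‖D^m (F(p, ·)) t‖ ≤ ‖D^m F (p, t)‖` (`F(p,·) = F ∘ (· + (p,0)) ∘ inr`, `‖inr‖ ≤ 1`). [folklore] -/
theorem norm_iteratedFDeriv_slice_le {F : (ℝ × ℝ) × MomSpace → ℂ} (hF : ContDiff ℝ ((⊤ : ℕ∞) : WithTop ℕ∞) F)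
    (p : ℝ × ℝ) (m : ℕ) (t : MomSpace) :
    ‖iteratedFDeriv ℝ m (fun t => F (p, t)) t‖ ≤ ‖iteratedFDeriv ℝ m F (p, t)‖ := by
  set g : (ℝ × ℝ) × MomSpace → ℂ := fun q => F (q + (p, 0)) with hg
  have hgc : ContDiff ℝ ((⊤ : ℕ∞) : WithTop ℕ∞) g := hF.comp (contDiff_id.add contDiff_const)
  have hcomp : (fun t => F (p, t)) = g ∘ (ContinuousLinearMap.inr ℝ (ℝ × ℝ) MomSpace) := by
    funext t; simp [hg]
  rw [hcomp, ContinuousLinearMap.iteratedFDeriv_comp_right _ hgc _ (by exact_mod_cast le_top)]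
  refine (ContinuousMultilinearMap.norm_compContinuousLinearMap_le _ _).trans ?_
  have hinr : ∏ _i : Fin m, ‖ContinuousLinearMap.inr ℝ (ℝ × ℝ) MomSpace‖ ≤ 1 :=
    Finset.prod_le_one (fun _ _ => norm_nonneg _) fun _ _ => ContinuousLinearMap.norm_inr_le_one ℝ (ℝ × ℝ) MomSpace
  have hshift : iteratedFDeriv ℝ m g (ContinuousLinearMap.inr ℝ (ℝ × ℝ) MomSpace t) = iteratedFDeriv ℝ m F (p, t) := by
    rw [hg, iteratedFDeriv_comp_add_right]
    congr 1
    simp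
  rw [hshift]
  exact mul_le_of_le_one_right (norm_nonneg _) hinr

section Uniform

variable {μ : ℝ} (hμ₁ : -4 < μ) (hμ₂ : μ < -2 - Real.sqrt 2)
include hμ₁ hμ₂

/-- **`h`-uniform derivative bounds of the rescaled sector symbols** (BGM 2006, Lemma 2.2: the
symbol estimates hold uniformly in `h`): for `0 < e₀ ≤ (4+μ)/2` and every order `m` there is
`B ≥ 0` with `‖D^m(rescaledSectorSymbol e₀ n ω)(t)‖ ≤ 4ⁿ B` for all `n`, all sectors `0 ≤ ω < 2^{n+1}`
and all `t`. [cite: BenfattoGiulianiMastropietro2006, §2.5 Lemma 2.2] -/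
theorem exists_norm_iteratedFDeriv_rescaledSectorSymbol_le {e₀ : ℝ} (he : 0 < e₀) (he' : e₀ ≤ (4 + μ) / 2) (m : ℕ) :
    ∃ B : ℝ, 0 ≤ B ∧ ∀ (n : ℕ) (ω : ℕ), ω < sectorCount n → ∀ t : MomSpace,
      ‖iteratedFDeriv ℝ m (rescaledSectorSymbol hμ₁ hμ₂ e₀ n ω) t‖ ≤ (4 : ℝ) ^ n * B := by
  -- the compact parameter × box set and a bound of the full derivative on it
  set P : Set (ℝ × ℝ) := Icc 0 (2 * π) ×ˢ Icc 0 1 with hP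
  set T : Set MomSpace := {t | |t 0| ≤ e₀ ∧ |t 1| ≤ normalExtentConst μ e₀ ∧ |t 2| ≤ tangentExtentConst μ e₀} with hT
  have hK : IsCompact (P ×ˢ T) := (isCompact_Icc.prod isCompact_Icc).prod (isCompact_momBox _ _ _)
  have hF := contDiff_masterLift hμ₁ hμ₂ he (μ := μ)
  have hcont : ContinuousOn (fun q : (ℝ × ℝ) × MomSpace => iteratedFDeriv ℝ m (masterLift μ e₀) q) (P ×ˢ T) :=
    (hF.continuous_iteratedFDeriv (by exact_mod_cast le_top)).continuousOn
  obtain ⟨B, hB⟩ := hK.exists_bound_of_continuousOn hcont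
  refine ⟨max B 0, le_max_right _ _, fun n ω hω t => ?_⟩
  set θ₀ : ℝ := ((ω : ℝ) + 1 / 2) * sectorWidth n with hθ₀
  set s : ℝ := (2 : ℝ) ^ (-(n : ℤ)) with hs
  have h4n : 0 < (4 : ℝ) ^ n := by positivity
  -- the parameters lie in `P`
  have hp : ((θ₀, s) : ℝ × ℝ) ∈ P := by
    have hw := sectorWidth_pos n
    have hN := sectorCount_mul_sectorWidth n
    have hω' : (ω : ℝ) + 1 ≤ sectorCount n := by exact_mod_cast hω
    refine ⟨⟨by positivity, ?_⟩, ⟨(zpow_pos (by norm_num) _).le, zpow_le_one_of_nonpos₀ (by norm_num) (by simp)⟩⟩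
    calc ((ω : ℝ) + 1 / 2) * sectorWidth n ≤ (sectorCount n : ℝ) * sectorWidth n :=
          mul_le_mul_of_nonneg_right (by linarith) hw.le
      _ = 2 * π := hN
  -- the symbol is `4ⁿ •` the slice of the master lift
  have heq : rescaledSectorSymbol hμ₁ hμ₂ e₀ n ω = fun t => (((4 : ℝ) ^ n : ℝ) : ℂ) • masterLift μ e₀ ((θ₀, s), t) := by
    have := rescaledSectorSymbol_eq_smul_masterLift hμ₁ hμ₂ he he' n (ω : ℤ)
    rw [Int.cast_natCast] at this
    exact this
  have hslice : ContDiff ℝ ((⊤ : ℕ∞) : WithTop ℕ∞) fun t : MomSpace => masterLift μ e₀ ((θ₀, s), t) :=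
    hF.comp (contDiff_const.prodMk contDiff_id)
  have hder : iteratedFDeriv ℝ m (rescaledSectorSymbol hμ₁ hμ₂ e₀ n ω) t =
      (((4 : ℝ) ^ n : ℝ) : ℂ) • iteratedFDeriv ℝ m (fun t : MomSpace => masterLift μ e₀ ((θ₀, s), t)) t := by
    rw [heq]
    exact iteratedFDeriv_const_smul_apply' ((hslice.of_le (by exact_mod_cast le_top)).contDiffAt)
  by_cases ht : t ∈ T
  · -- on the box: the compactness bound
    rw [hder, norm_smul, Complex.norm_real, Real.norm_eq_abs, abs_of_pos h4n]
    refine mul_le_mul_of_nonneg_left ?_ h4n.le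
    exact ((norm_iteratedFDeriv_slice_le hF (θ₀, s) m t).trans (hB _ (mk_mem_prod hp ht))).trans (le_max_left _ _)
  · -- off the box: the symbol vanishes identically near `t`
    have hsupp : tsupport (rescaledSectorSymbol hμ₁ hμ₂ e₀ n ω) ⊆ T := by
      refine closure_minimal (fun u hu => ?_) (isCompact_momBox _ _ _).isClosed
      exact abs_le_of_rescaledSectorSymbol_ne_zero hμ₁ hμ₂ he he' hu
    have h0 : iteratedFDeriv ℝ m (rescaledSectorSymbol hμ₁ hμ₂ e₀ n ω) t = 0 := by
      by_contra hne
      exact ht (hsupp (support_iteratedFDeriv_subset m (Function.mem_support.2 hne)))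
    rw [h0, norm_zero]
    positivity

end Uniform

end Literature.MathematicalPhysics.QuantumLattice

end
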